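import Mathlib
import Literature.NumberTheory.ModularForms.SturmCongruenceBoundProofs
import Literature.NumberTheory.Automorphic.HilbertPartialHasseWeightShiftingProofs
import Summits.Langlands.Langlands.Theorems.CapacityClassicalityIntegralOverconvergentIsCongruenceStubSupNormOfSturm
import Summits.Langlands.Langlands.Theorems.CapacityClassicalityHilbertIntegralOverconvergentIsCongruenceStubModularSupNormOfCusp
import Summits.Langlands.Langlands.Theorems.CapacityClassicalityHilbertIntegralOverconvergentIsCongruenceStubEisensteinCoeff
import Summits.Langlands.Langlands.Theorems.CapacityClassicalityHilbertIntegralOverconvergentIsCongruenceAlgebraicHalf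

/-!
# Crux `HilbertIntegralOverconvergentIsCongruence` (stmt-Langlands-8485), line `Sketch-ideate-r1-k1`:
# the algebraization engine, `d = 1` — II. the GAIN on the Sturm family `V b = ι⁻¹ M_b(Γ₁(N))`

Part II of the proof of the registered stub R8 `stub_algebraicMain` (RESHAPE 4 of the skeleton
`Cruxes/HilbertIntegralOverconvergentIsCongruence/Lines/Sketch_ideate_r1_k1.lean`):

* `algMain_sturmFamily` — the graded family `V b = {ι⁻¹(qExpansion F) : F ∈ M_b(Γ₁(N))}` of `p`-adic
  `q`-expansions: a family of `ℚ̄_p`-subspaces closed under products, containing `ι⁻¹ E_{p-1}`, with the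
  sup-norm Sturm principle of line `⌊(12 + b)·[SL₂(ℤ):Γ₁(N)]/12⌋` — Sturm's congruence theorem, PROVED
  in the tree (`Sturm1987_congruenceBound_Gamma1_modPrime_holds`), through the sibling line's
  `CapacityClassicality.stub_supNormOfSturm` and the `Δ`-twist `stub_modularSupNormOfCusp`;
* `algMain_baseDatum` — α's Katz datum read `p`-adically (von Staudt–Clausen for `E_{p-1}`, stub 2);
* `stub_gainBound` (registered stub R8b) — the GAIN of the Schneider–Lang assembly: for the
  `p`-adic polynomial expression `F_P = Σ_u v(P_u) · f_u · G^{j_u}` (`f_u` integral level-one forms of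
  weight `12uD - j_u k`, `j_u ≤ D`, `P_u ∈ 𝓞_E`), vanishing of its coefficients below `n` forces
  `‖coeff_ν F_P‖ ≤ (max(1,C)·A)^D R^{-n}` for every `ν`, via the Katz-data algebra (stub R4, hypothesis)
  and the arithmetic of the gain (stub R5's output, hypothesis `hconv`), the lever being the landed
  `stub_gradedKatzGainFree` (stubs 13, 14, 15, 18).

Theorems only, no `sorry`.
-/

set_option linter.dupNamespace false

noncomputable section

open scoped MatrixGroups NumberField

namespace Summit.Langlands.Langlands.Theorems.HilbertIntegralOverconvergentIsCongruence

/-! ### The `p`-adic Sturm family `V b = ι⁻¹ M_b(Γ₁(N))` -/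

/-- Level-one forms restrict to `Γ₁(N)` without changing the underlying function. [folklore] -/
theorem algMain_restrict (N : ℕ) {b : ℤ} (F : ModularForm 𝒮ℒ b) :
    ∃ F' : ModularForm (CongruenceSubgroup.Gamma1 N) b, (⇑F' : UpperHalfPlane → ℂ) = ⇑F := by
  have hle : (CongruenceSubgroup.Gamma1 N : Subgroup (GL (Fin 2) ℝ)) ≤ 𝒮ℒ := by
    rintro _ ⟨g, -, rfl⟩
    exact ⟨g, rfl⟩
  exact ⟨{ toFun := ⇑F
           slash_action_eq' := fun γ hγ ↦ SlashInvariantFormClass.slash_action_eq F γ (hle hγ)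
           holo' := F.holo'
           bdd_at_cusps' := fun hc' ↦ F.bdd_at_cusps' (hc'.mono hle) }, rfl⟩

/-- **The Sturm family.**  For `p ≥ 5` prime (any level `N`, `p ∤ N`), along `ι : ℚ̄_p ≃ ℂ`, the
family `V b = {ι⁻¹(qExpansion F) : F ∈ M_b(Γ₁(N))}` of `p`-adic `q`-expansions is a graded family of
`ℚ̄_p`-subspaces of `ℚ̄_p⟦q⟧` closed under products, containing `ι⁻¹ E_{p-1}` in weight `p - 1`, and
it satisfies the sup-norm Sturm principle with the line `⌊(12 + b)·[SL₂(ℤ):Γ₁(N)]/12⌋` (Sturm's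
congruence theorem, PROVED in the tree, through the sibling line's `stub_supNormOfSturm` and the
`Δ`-twist `stub_modularSupNormOfCusp`). [folklore] -/
theorem algMain_sturmFamily (p : ℕ) [Fact p.Prime] (hp : 5 ≤ p) (N : ℕ) [NeZero N] (hpN : ¬ p ∣ N)
    (ι : PadicAlgCl p ≃+* ℂ) :
    ∃ V : ℤ → Set (MvPowerSeries Unit (PadicAlgCl p)),
      (∀ b, V b = {φ | ∃ F : ModularForm (CongruenceSubgroup.Gamma1 N) b,
        φ = PowerSeries.map ι.symm.toRingHom (UpperHalfPlane.qExpansion 1 ⇑F)}) ∧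
      (1 : MvPowerSeries Unit (PadicAlgCl p)) ∈ V 0 ∧
      (∀ b : ℤ, (0 : MvPowerSeries Unit (PadicAlgCl p)) ∈ V b) ∧
      (∀ (b : ℤ) (φ ψ : MvPowerSeries Unit (PadicAlgCl p)), φ ∈ V b → ψ ∈ V b → φ + ψ ∈ V b) ∧
      (∀ (b : ℤ) (c : PadicAlgCl p) (φ : MvPowerSeries Unit (PadicAlgCl p)), φ ∈ V b → c • φ ∈ V b) ∧
      (∀ (b₁ b₂ : ℤ) (φ ψ : MvPowerSeries Unit (PadicAlgCl p)),
        φ ∈ V b₁ → ψ ∈ V b₂ → φ * ψ ∈ V (b₁ + b₂)) ∧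
      (∀ (b : ℤ) (s : Finset ℕ) (φ : ℕ → MvPowerSeries Unit (PadicAlgCl p)),
        (∀ i ∈ s, φ i ∈ V b) → (∑ i ∈ s, φ i) ∈ V b) ∧
      PowerSeries.map ι.symm.toRingHom
        (UpperHalfPlane.qExpansion 1 ⇑(ModularForm.E (show 3 ≤ p - 1 by omega))) ∈ V ((p - 1 : ℕ) : ℤ) ∧
      (∀ (b : ℤ), ∀ T ∈ V b, ∀ B : ℝ, 0 ≤ B →
        (∀ n : Unit →₀ ℕ, n () < ((12 + b) * ((CongruenceSubgroup.Gamma1 N).index : ℤ)).toNat / 12 →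
          ‖MvPowerSeries.coeff n T‖ ≤ B) →
        ∀ n : Unit →₀ ℕ, ‖MvPowerSeries.coeff n T‖ ≤ B) := by
  classical
  set j : ℂ →+* PadicAlgCl p := ι.symm.toRingHom with hj_def
  have hj : ∀ x, j x = ι.symm x := fun x ↦ rfl
  have hΓ : (1 : ℝ) ∈ (CongruenceSubgroup.Gamma1 N : Subgroup (GL (Fin 2) ℝ)).strictPeriods := by
    rw [CongruenceSubgroup.strictPeriods_Gamma1]
    exact AddSubgroup.mem_zmultiples 1
  refine ⟨fun b ↦ {φ | ∃ F : ModularForm (CongruenceSubgroup.Gamma1 N) b,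
    φ = PowerSeries.map j (UpperHalfPlane.qExpansion 1 ⇑F)}, fun b ↦ rfl, ?_, ?_, ?_, ?_, ?_, ?_, ?_, ?_⟩
  · -- one
    exact ⟨1, by rw [ModularForm.qExpansion_one, map_one]⟩
  · -- zero
    intro b
    refine ⟨0, ?_⟩
    rw [ModularForm.coe_zero, UpperHalfPlane.qExpansion_zero, map_zero]
  · -- add
    rintro b φ ψ ⟨F, rfl⟩ ⟨G, rfl⟩
    refine ⟨F + G, ?_⟩
    rw [ModularForm.coe_add, ModularForm.qExpansion_add one_pos hΓ, map_add]
  · -- smul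
    rintro b c φ ⟨F, rfl⟩
    refine ⟨(ι c) • F, ?_⟩
    rw [ModularForm.IsGLPos.coe_smul, ModularForm.qExpansion_smul one_pos hΓ]
    ext n
    rw [PowerSeries.coeff_smul, PowerSeries.coeff_map, PowerSeries.coeff_map, PowerSeries.coeff_smul,
      smul_eq_mul, smul_eq_mul, map_mul, hj, hj, RingEquiv.symm_apply_apply]
  · -- mul
    rintro b₁ b₂ φ ψ ⟨F, rfl⟩ ⟨G, rfl⟩
    refine ⟨F.mul G, ?_⟩
    rw [ModularForm.qExpansion_mul one_pos hΓ, map_mul]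
  · -- finite sums
    intro b s φ hφ
    induction s using Finset.induction_on with
    | empty =>
      rw [Finset.sum_empty]
      exact ⟨0, by rw [ModularForm.coe_zero, UpperHalfPlane.qExpansion_zero, map_zero]⟩
    | insert i s his ih =>
      rw [Finset.sum_insert his]
      obtain ⟨F, hF⟩ := hφ i (Finset.mem_insert_self i s)
      obtain ⟨G, hG⟩ := ih fun i' hi' ↦ hφ i' (Finset.mem_insert_of_mem hi')
      refine ⟨F + G, ?_⟩
      rw [hF, hG, ModularForm.coe_add, ModularForm.qExpansion_add one_pos hΓ, map_add]
  · -- the Hasse lift `E_{p-1}` restricted to `Γ₁(N)`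
    obtain ⟨E', hE'⟩ := algMain_restrict N (ModularForm.E (show 3 ≤ p - 1 by omega))
    exact ⟨E', by rw [hE']⟩
  · -- the sup-norm Sturm principle
    rintro b T ⟨F, rfl⟩ B hB hsmall n
    have hSup := CapacityClassicality.stub_supNormOfSturm p N
      (fun k' f z hz hdiv ↦
        Literature.NumberTheory.ModularForms.Sturm1987_congruenceBound_Gamma1_modPrime_holds N p Fact.out
          hpN k' f z hz hdiv) ι
    obtain ⟨m₀, rfl⟩ : ∃ m₀ : ℕ, n = Finsupp.single () m₀ := ⟨n (), Finsupp.unique_single n⟩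
    have key := stub_modularSupNormOfCusp p N ι hSup b F B hB (fun m hm ↦ by
      have := hsmall (Finsupp.single () m) (by simpa using hm)
      rwa [PowerSeries.coeff_coeToMvPowerSeries, PowerSeries.coeff_map] at this) m₀
    rw [PowerSeries.coeff_coeToMvPowerSeries, PowerSeries.coeff_map]
    exact key

/-! ### The base Katz datum of α, read `p`-adically -/

/-- **α's Katz datum in `ℚ̄_p⟦q⟧`.**  Reading the Katz datum `(c_i)` of α through `ι⁻¹`: the Hasse
lift `e = ι⁻¹ E_{p-1}` has constant term `1` and integral coefficients (von Staudt–Clausen, stub 2),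
`a_i = ι⁻¹ c_i` has `‖a_i‖ ≤ max(1,C) · (p^{-r})^i`, and the Katz sum `Σ_i a_i e^{-i}` converges
coefficientwise to `G = Σ g_n qⁿ`. [folklore] -/
theorem algMain_baseDatum (p : ℕ) [Fact p.Prime] (hp : 5 ≤ p) (ι : PadicAlgCl p ≃+* ℂ)
    (r C : ℝ) (c : ℕ → PowerSeries ℂ) (hr : 0 < r)
    (hbound : ∀ i n : ℕ, ‖ι.symm (PowerSeries.coeff n (c i))‖ ≤ C * (p : ℝ) ^ (-(r * i)))
    (g : ℕ → PadicAlgCl p)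
    (hg : ∀ n : ℕ, HasSum (fun i : ℕ ↦ ι.symm (PowerSeries.coeff n (c i *
      ((UpperHalfPlane.qExpansion 1 ⇑(ModularForm.E (show 3 ≤ p - 1 by omega)))⁻¹) ^ i))) (g n)) :
    MvPowerSeries.constantCoeff (PowerSeries.map ι.symm.toRingHom
      (UpperHalfPlane.qExpansion 1 ⇑(ModularForm.E (show 3 ≤ p - 1 by omega)))) = 1 ∧
    (∀ n : Unit →₀ ℕ, ‖MvPowerSeries.coeff n (PowerSeries.map ι.symm.toRingHom
      (UpperHalfPlane.qExpansion 1 ⇑(ModularForm.E (show 3 ≤ p - 1 by omega))))‖ ≤ 1) ∧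
    0 < (p : ℝ) ^ (-r) ∧ (p : ℝ) ^ (-r) < 1 ∧
    (∀ (i : ℕ) (n : Unit →₀ ℕ), ‖MvPowerSeries.coeff n (PowerSeries.map ι.symm.toRingHom (c i))‖ ≤
      max 1 C * ((p : ℝ) ^ (-r)) ^ i) ∧
    (∀ n : Unit →₀ ℕ, HasSum (fun i : ℕ ↦ MvPowerSeries.coeff n
      (PowerSeries.map ι.symm.toRingHom (c i) *
        (PowerSeries.map ι.symm.toRingHom
          (UpperHalfPlane.qExpansion 1 ⇑(ModularForm.E (show 3 ≤ p - 1 by omega))))⁻¹ ^ i))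
      (MvPowerSeries.coeff n (PowerSeries.mk g : PowerSeries (PadicAlgCl p)))) := by
  classical
  set qE : PowerSeries ℂ := UpperHalfPlane.qExpansion 1 ⇑(ModularForm.E (show 3 ≤ p - 1 by omega))
    with hqE_def
  set j : ℂ →+* PadicAlgCl p := ι.symm.toRingHom with hj_def
  have hj : ∀ x, j x = ι.symm x := fun x ↦ rfl
  have hpeven : Even (p - 1) := by
    have hodd : Odd p := (Fact.out : p.Prime).odd_of_ne_two (by omega)
    obtain ⟨t, ht⟩ := hodd
    exact ⟨t, by omega⟩
  have hqE0 : PowerSeries.constantCoeff qE = 1 := by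
    rw [← PowerSeries.coeff_zero_eq_constantCoeff_apply, hqE_def]
    exact EisensteinSeries.E_qExpansion_coeff_zero _ hpeven
  have hqE0' : PowerSeries.constantCoeff qE ≠ 0 := by rw [hqE0]; exact one_ne_zero
  set e : PowerSeries (PadicAlgCl p) := PowerSeries.map j qE with he_def
  have he0 : PowerSeries.constantCoeff e = 1 := by
    rw [he_def, ← PowerSeries.coeff_zero_eq_constantCoeff_apply, PowerSeries.coeff_map,
      PowerSeries.coeff_zero_eq_constantCoeff_apply, hqE0, map_one]
  have hee' : e * PowerSeries.map j qE⁻¹ = 1 := by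
    rw [he_def, ← map_mul, PowerSeries.mul_inv_cancel qE hqE0', map_one]
  have he'inv : PowerSeries.map j qE⁻¹ = e⁻¹ := by
    rw [PowerSeries.eq_inv_iff_mul_eq_one (by rw [he0]; exact one_ne_zero), mul_comm]
    exact hee'
  have hp1 : (1 : ℝ) < p := by exact_mod_cast (Fact.out : p.Prime).one_lt
  have hρ0 : 0 < (p : ℝ) ^ (-r) := Real.rpow_pos_of_pos (by positivity) _
  have hρ1 : (p : ℝ) ^ (-r) < 1 := Real.rpow_lt_one_of_one_lt_of_neg hp1 (by linarith)
  refine ⟨he0, ?_, hρ0, hρ1, ?_, ?_⟩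
  · -- integrality of the Hasse lift
    intro n
    obtain ⟨m, rfl⟩ : ∃ m : ℕ, n = Finsupp.single () m := ⟨n (), Finsupp.unique_single n⟩
    rw [PowerSeries.coeff_coeToMvPowerSeries, he_def, PowerSeries.coeff_map, hj]
    exact stub_eisensteinCoeff p hp ι m
  · -- the norm family
    intro i n
    obtain ⟨m, rfl⟩ : ∃ m : ℕ, n = Finsupp.single () m := ⟨n (), Finsupp.unique_single n⟩
    rw [PowerSeries.coeff_coeToMvPowerSeries, PowerSeries.coeff_map, hj]
    refine (hbound i m).trans ?_
    rw [← Real.rpow_mul_natCast (by positivity), neg_mul]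
    exact mul_le_mul_of_nonneg_right (le_max_right 1 C) (Real.rpow_nonneg (by positivity) _)
  · -- the sum family
    intro n
    obtain ⟨m, rfl⟩ : ∃ m : ℕ, n = Finsupp.single () m := ⟨n (), Finsupp.unique_single n⟩
    have h := hg m
    simp_rw [PowerSeries.coeff_coeToMvPowerSeries, PowerSeries.coeff_mk]
    convert h using 1
    funext i
    rw [← he'inv, ← map_pow, ← map_mul, PowerSeries.coeff_map, hj]

/-! ### The gain (registered stub R8b) -/

/-- **Registered stub R8b (`stub_gainBound`) of line `Sketch-ideate-r1-k1`: the GAIN.**  `p ≥ 5`,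
`p ∤ N`, α's Katz datum `(c_i)` of weight `k` and rate `r` along `ι` summing to `g = Σ σ₀(aₙ)qⁿ`, the
Katz-data algebra (stub R4, hypothesis `hR4`) and the arithmetic of the gain at `ρ = p^{-r}`,
`μ = [SL₂(ℤ):Γ₁(N)]`, `t = p - 1`, `c₀ = 12u` (stub R5's output, hypothesis `hconv`).  Then for finitely
many exponents `j_u ≤ D` (`D ≥ 1`), integral level-one forms `f_u` of weight `12uD - j_u k` (given by
integer series `fZ u`) and scalars `P_u ∈ 𝓞_E`, the `p`-adic series
`F_P = Σ_u ι⁻¹σ₀(P_u) · fZ_u · (ι⁻¹σ₀ g)^{j_u}` satisfies: if its coefficients vanish below `n` then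
`‖coeff_ν F_P‖ ≤ (max(1,C)·A)^D · R^{-n}` for every `ν`. [folklore] -/
theorem stub_gainBound (p : ℕ) [Fact p.Prime] (hp : 5 ≤ p) (N : ℕ) [NeZero N] (hpN : ¬ p ∣ N) (k : ℤ)
    (ι : PadicAlgCl p ≃+* ℂ) (E : Type) [Field E] [NumberField E] (σ₀ : E →+* ℂ) (a : ℕ → E)
    (hR4 : ∀ {K σ U : Type} [NormedField K] [IsUltrametricDist K] [Fintype U]
      (V : ℤ → Set (MvPowerSeries σ K)) (_ : (1 : MvPowerSeries σ K) ∈ V 0)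
      (_ : ∀ b : ℤ, (0 : MvPowerSeries σ K) ∈ V b)
      (_ : ∀ (b : ℤ) (φ ψ : MvPowerSeries σ K), φ ∈ V b → ψ ∈ V b → φ + ψ ∈ V b)
      (_ : ∀ (b : ℤ) (c : K) (φ : MvPowerSeries σ K), φ ∈ V b → c • φ ∈ V b)
      (_ : ∀ (b₁ b₂ : ℤ) (φ ψ : MvPowerSeries σ K), φ ∈ V b₁ → ψ ∈ V b₂ → φ * ψ ∈ V (b₁ + b₂))
      (e : MvPowerSeries σ K) (t : ℤ) (_ : MvPowerSeries.constantCoeff e = 1)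
      (_ : ∀ n, ‖MvPowerSeries.coeff n e‖ ≤ 1)
      (a : ℕ → MvPowerSeries σ K) (w : ℤ) (_ : ∀ i : ℕ, a i ∈ V (w + i * t))
      (ρ C : ℝ) (_ : 0 ≤ ρ) (_ : ρ ≤ 1) (_ : 1 ≤ C) (_ : ∀ i n, ‖MvPowerSeries.coeff n (a i)‖ ≤ C * ρ ^ i)
      (G : MvPowerSeries σ K)
      (_ : ∀ n, HasSum (fun i : ℕ ↦ MvPowerSeries.coeff n (a i * e⁻¹ ^ i)) (MvPowerSeries.coeff n G))
      (D : ℕ) (j : U → ℕ) (_ : ∀ u, j u ≤ D) (T : ℤ)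
      (f : U → MvPowerSeries σ K) (_ : ∀ u, f u ∈ V (T - j u * w))
      (_ : ∀ u n, ‖MvPowerSeries.coeff n (f u)‖ ≤ 1) (l : U → K) (_ : ∀ u, ‖l u‖ ≤ 1),
      ∃ A : ℕ → MvPowerSeries σ K,
        (∀ i : ℕ, A i ∈ V (T + i * t)) ∧ (∀ i n, ‖MvPowerSeries.coeff n (A i)‖ ≤ C ^ D * ρ ^ i) ∧
        (∀ n, HasSum (fun i : ℕ ↦ MvPowerSeries.coeff n (A i * e⁻¹ ^ i))
          (MvPowerSeries.coeff n (∑ u, l u • (f u * G ^ j u)))) ∧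
        ∀ n, ‖MvPowerSeries.coeff n (∑ u, l u • (f u * G ^ j u))‖ ≤ C ^ D)
    (μ : ℕ) (hμ : μ = (CongruenceSubgroup.Gamma1 N).index) (u : ℕ)
    (r C : ℝ) (c : ℕ → PowerSeries ℂ) (hr : 0 < r)
    (hc : ∀ i : ℕ, ∃ F : ModularForm (CongruenceSubgroup.Gamma1 N) (k + i * (p - 1 : ℕ)),
      c i = UpperHalfPlane.qExpansion 1 ⇑F)
    (hbound : ∀ i n : ℕ, ‖ι.symm (PowerSeries.coeff n (c i))‖ ≤ C * (p : ℝ) ^ (-(r * i)))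
    (hsum : ∀ n : ℕ, HasSum (fun i : ℕ ↦ ι.symm (PowerSeries.coeff n (c i *
      ((UpperHalfPlane.qExpansion 1 ⇑(ModularForm.E (show 3 ≤ p - 1 by omega)))⁻¹) ^ i)))
      (ι.symm (σ₀ (a n))))
    (A₅ R : ℝ)
    (hconv : ∀ (D n₀ : ℕ) (x C'' : ℝ), 1 ≤ D → 0 ≤ C'' → x ≤ C'' →
      (∀ M : ℕ, ((12 + ((((12 * u * D : ℕ) : ℤ)) + (M : ℤ) * ((p - 1 : ℕ) : ℤ))) * (μ : ℤ)).toNat / 12 ≤ n₀ →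
        x ≤ C'' * ((p : ℝ) ^ (-r)) ^ (M + 1)) → x ≤ C'' * A₅ ^ D * R⁻¹ ^ n₀)
    {U : Type} [Fintype U] (D : ℕ) (hD1 : 1 ≤ D) (jU : U → ℕ) (hjU : ∀ uu, jU uu ≤ D)
    (fZ : U → PowerSeries ℤ)
    (hfU : ∀ uu, ∃ F : ModularForm 𝒮ℒ ((((12 * u * D : ℕ) : ℤ)) - (jU uu : ℤ) * k),
      UpperHalfPlane.qExpansion 1 ⇑F = (fZ uu).map (Int.castRingHom ℂ))
    (lO : U → 𝓞 E) (FPK : PowerSeries (PadicAlgCl p))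
    (hFPK : FPK = ∑ uu, (ι.symm (σ₀ ((lO uu : 𝓞 E) : E))) •
      ((fZ uu).map (Int.castRingHom (PadicAlgCl p)) *
        (PowerSeries.mk fun n ↦ ι.symm (σ₀ (a n))) ^ jU uu))
    (n : ℕ) (hvan : ∀ m < n, PowerSeries.coeff (R := PadicAlgCl p) m FPK = 0) (ν : ℕ) :
    ‖PowerSeries.coeff (R := PadicAlgCl p) ν FPK‖ ≤ (max 1 C * A₅) ^ D * R⁻¹ ^ n := by
  classical
  obtain ⟨V, hVdef, hV1, hV0, hVadd, hVsmul, hVmul, hVsum, heV, hSturmV⟩ :=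
    algMain_sturmFamily p hp N hpN ι
  rw [← hμ] at hSturmV
  obtain ⟨he0, heint, hρ0, hρ1, haK, hGK⟩ :=
    algMain_baseDatum p hp ι r C c hr hbound (fun n ↦ ι.symm (σ₀ (a n))) hsum
  have hC'1 : (1 : ℝ) ≤ max 1 C := le_max_left _ _
  have haKV : ∀ i : ℕ, (fun i ↦ PowerSeries.map ι.symm.toRingHom (c i)) i ∈ V (k + i * ((p - 1 : ℕ) : ℤ)) := by
    intro i
    rw [hVdef]
    obtain ⟨F, hF⟩ := hc i
    exact ⟨F, by dsimp only; rw [hF]⟩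
  -- hypotheses of the Katz-data algebra (R4)
  have hfV : ∀ uu : U, (fun uu ↦ PowerSeries.map (Int.castRingHom (PadicAlgCl p)) (fZ uu)) uu ∈
      V ((((12 * u * D : ℕ) : ℤ)) - ((jU uu : ℕ) : ℤ) * k) := by
    intro uu
    rw [hVdef]
    obtain ⟨F, hF⟩ := hfU uu
    obtain ⟨F', hF'⟩ := algMain_restrict N F
    refine ⟨F', ?_⟩
    rw [hF', hF]
    ext m
    simp only [PowerSeries.coeff_map, eq_intCast, map_intCast]
  have hf1 : ∀ (uu : U) (nn : Unit →₀ ℕ), ‖MvPowerSeries.coeff (R := PadicAlgCl p) nn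
      ((fun uu ↦ PowerSeries.map (Int.castRingHom (PadicAlgCl p)) (fZ uu)) uu)‖ ≤ 1 := by
    intro uu nn
    obtain ⟨m, rfl⟩ : ∃ m : ℕ, nn = Finsupp.single () m := ⟨nn (), Finsupp.unique_single nn⟩
    rw [PowerSeries.coeff_coeToMvPowerSeries]
    dsimp only
    rw [PowerSeries.coeff_map, eq_intCast]
    exact IsUltrametricDist.norm_intCast_le_one (PadicAlgCl p) _
  have hl1 : ∀ uu : U, ‖(fun uu ↦ ι.symm (σ₀ ((lO uu : 𝓞 E) : E))) uu‖ ≤ 1 := by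
    intro uu
    exact Literature.NumberTheory.Automorphic.PadicAlgCl.norm_le_one_of_isIntegral p
      ((NumberField.RingOfIntegers.isIntegral_coe (lO uu)).map (ι.symm.toRingHom.comp σ₀).toIntAlgHom)
  obtain ⟨AK, hAKV, hAKnorm, hAKsum, hAKtriv⟩ := hR4 (K := PadicAlgCl p) (σ := Unit) (U := U) V
    hV1 hV0 hVadd hVsmul hVmul _ ((p - 1 : ℕ) : ℤ) he0 heint _ k haKV _ _ hρ0.le hρ1.le hC'1 haK
    _ hGK D jU hjU (((12 * u * D : ℕ) : ℤ)) _ hfV hf1 _ hl1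
  rw [← hFPK] at hAKsum hAKtriv
  -- the graded gain below every admissible Sturm line
  have hC'D : 0 ≤ (max 1 C) ^ D := pow_nonneg (zero_le_one.trans hC'1) _
  have hgainM : ∀ M : ℕ,
      ((12 + ((((12 * u * D : ℕ) : ℤ)) + (M : ℤ) * ((p - 1 : ℕ) : ℤ))) * (μ : ℤ)).toNat / 12 ≤ n →
      ∀ nn : Unit →₀ ℕ, ‖MvPowerSeries.coeff (R := PadicAlgCl p) nn FPK‖ ≤
        (max 1 C) ^ D * ((p : ℝ) ^ (-r)) ^ (M + 1) := by
    intro M hM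
    refine stub_gradedKatzGainFree V hV1 hVmul hVsum
      (fun b ↦ {nn : Unit →₀ ℕ | nn () < ((12 + b) * (μ : ℤ)).toNat / 12})
      (fun b T hT B hB h ↦ hSturmV b T hT B hB (fun nn hnn ↦ h nn hnn)) (fun nn ↦ nn ())
      (fun x y h ↦ h ()) (fun b ↦ ((12 + b) * (μ : ℤ)).toNat / 12) (fun b nn hnn ↦ hnn) _
      ((p - 1 : ℕ) : ℤ) he0 heint heV AK (((12 * u * D : ℕ) : ℤ)) hAKV _ ((max 1 C) ^ D) hρ0.le hρ1.le
      hC'D hAKnorm FPK hAKsum n ?_ M hM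
    intro nn hnn
    obtain ⟨m, rfl⟩ : ∃ m : ℕ, nn = Finsupp.single () m := ⟨nn (), Finsupp.unique_single nn⟩
    have hmn : m < n := by simpa using hnn
    rw [PowerSeries.coeff_coeToMvPowerSeries]
    exact hvan m hmn
  -- the arithmetic of the gain at the coefficient `ν`
  have hx : ‖PowerSeries.coeff (R := PadicAlgCl p) ν FPK‖ ≤ (max 1 C) ^ D * A₅ ^ D * R⁻¹ ^ n := by
    refine hconv D n _ ((max 1 C) ^ D) hD1 hC'D ?_ ?_
    · have := hAKtriv (Finsupp.single () ν)
      rwa [PowerSeries.coeff_coeToMvPowerSeries] at this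
    · intro M hM
      have := hgainM M hM (Finsupp.single () ν)
      rwa [PowerSeries.coeff_coeToMvPowerSeries] at this
  calc ‖PowerSeries.coeff (R := PadicAlgCl p) ν FPK‖ ≤ (max 1 C) ^ D * A₅ ^ D * R⁻¹ ^ n := hx
    _ = (max 1 C * A₅) ^ D * R⁻¹ ^ n := by rw [mul_pow]

end Summit.Langlands.Langlands.Theorems.HilbertIntegralOverconvergentIsCongruence

end
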